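import Literature.Analysis.OperatorTheory.Enflo2023.StepRealisationDiagNStart
import HarnessLib

/-!
# Enflo (2023), Part B — the orbit residual fails AT THE TEXT'S OWN MODULUS from starts whose `x₀` is far from
the invariant subspaces: a type-1 model on `ℂ³` (`StepRealisation.Far`)

Source: P. H. Enflo, arXiv:2305.15442v2 — a CLAIMED result under adjudication (b2b-enflo repair cell, formaliser 2).
This file records theorems ABOUT TYPED INFERENCES OF THE TEXT, partly in an explicit finite-dimensional model;
nothing here concludes the invariant subspace problem for any operator (the model operator trivially has invariant
subspaces).  BLOCK-2b value: a calibration of the located Part-B residual `StepRealisation.IndepRunD` — v2 (34) p.16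
with ONE modulus along everything the construction visits, p.19 l.655–677 — at the modulus the text actually uses.

WHAT THIS FILE DECIDES.  The record's calibrations of `IndepRunD` (`StepRealisationToy`, `…Diag`, `…DiagN*`) refute
it only at LARGE modulus `σ ≥ 100‖T‖`, a regime disjoint from the text's `σ = δ₂ ≤ ‖T‖²`
(`StepRealisationDiagLow.type1Const_le_opNorm_sq`, `not_calibrationRegime_of_modulus_le_sq`), and at the text's modulus the
`d = 2` model carries a CONSISTENT scheduled orbit (`StepRealisationDiagLow`, `…DiagIndep`); GAP.md §"Formaliser 2
gen-18" G4 (iii) therefore recorded the text's-modulus question as undecided by the record.  Here it is decided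
NEGATIVELY for a class of starts, by a mechanism that does not see the modulus at all.

* §A THE LOCATED ENDGAME (`HasMCLimit`, `hasMCLimit_of_indepRunD`; general Hilbert space): the kernel chain
  `IndepRunD ⇒ ClaimG ⇒ run ⇒ rooms ⇒ (11)` (`StepRealisationOrbit.nis_of_indepRunD`) in fact produces a vector
  `w ≠ 0` with `0.3 ≤ ‖x₀ − w‖ ≤ 0.7` whose orbit is orthogonal to `x₀ − w` — a NON-CYCLIC vector within `0.7` of
  `x₀` (v2 (11) p.4, p.20–22: the limit of the moved parts `ℓ_n(T)y_n`).  The chain's modules conclude only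
  `HasNontrivialClosedInvariantSubspace T`; the located form is the same proofs with the witness kept.
* §B THE MODEL `T_{w₀,τ}` on `ℂ³` (`Far.TF`: `u₀ ↦ w₀u₀`, `u₁ ↦ τu₂`, `u₂ ↦ 0` in the standard basis `u_i`): of
  TYPE 1 with the text's `u₀` (`Far.type1`, `Far.type1_const`: `⟨Tʲy, y⟩ = w₀ʲ|y₀|²` for `j ≥ 2`, so
  `δ_n = 10⁻⁴w₀ⁿ⁺²`), `‖T‖ = w₀` for `0 ≤ τ ≤ w₀` (`Far.opNorm_TF`), cyclic vectors = those with `y₀y₁ ≠ 0`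
  (`Far.cyclic_of_ne`).  Its non-trivial invariant subspaces are `ℂu₀, ℂu₂, ℂu₁ ⊕ ℂu₂, ℂu₀ ⊕ ℂu₂`, so a unit `x₀`
  with `|x₀,₀| > 0.7` AND `|x₀,₁| > 0.7` is MORE THAN `0.7` AWAY FROM EVERY ONE OF THEM; the file proves the
  consequence it needs directly (`Far.lt_norm_sub_of_orbit_orthogonal`: `x₀ − w ⊥ w, Tw, T²w` and `x₀ ≠ w` force
  `‖x₀ − w‖ > 0.7`).
* §C HENCE (`Far.not_indepRunD_of_far`): over such an `x₀`, `IndepRunD T x₀ S (ιS S) σ β s₀` is FALSE for EVERY true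
  MC start `s₀` with the run's start margin, EVERY modulus `0 < σ ≤ 1` and EVERY ratio `0 < β ≤ σ²/1000` — in
  particular at `σ = δ₂`, however small.
* §D NON-VACUITY (`Far.exists_far_start`, bracket form as in `DiagN.exists_start`): for `τ = α²` the intertwiner
  `W_α b = (c₀⟪g_{w₀}, b⟫, b₀/α, (α − 1/α)b₀ + αb₁)` (`c₀ = 2/(α(1 + w₀))`; `W_αS = TW_α`) and `ẑ = u₁ + u₂` give
  `W_α†ẑ = α(e₀ + e₁)` (`e_j` the basis of `ℓ²`) and `ẑ + W_αW_α†ẑ = (2, 2, 2α²)`; normalising,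
  `x₀ = (1, 1, α²)/√(2 + α⁴)` (`|x₀,₀| = |x₀,₁| > 0.7`) carries a TRUE MC state of `W_α` with
  `ε² = 1/(4 + 2α⁴)`, `(εθ)₀ = α²/(4 + 2α⁴) > 0`, and the start margin `(22/σ + 1)(εθ)₀` as soon as `α² ≤ σ/100`.
* §E HEADLINE (`Far.fails`): for every `0 < w₀ < 1`, `0 < σ ≤ 1` and `0 < α² ≤ σ/100` the type-1 operator
  `T_{w₀,α²}` has an admissible start — cyclic unit `x₀`, cyclic `y₀ = W_αe₀`, `(εθ)₀ > 0`, start margin — at which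
  `IndepRunD` fails with modulus `σ` for every ratio `0 < β ≤ σ²/1000`.  At the standing numbers
  (`Far.fails_at_text_modulus`: `w₀ = 10⁻²⁰ = ‖T‖`, `α = 10⁻²⁵`) ONE operator serves every `σ ∈ [10⁻⁴⁸, 1]`, a
  range containing its natural type-1 constant `δ₂ = 10⁻⁴w₀² = 10⁻⁴⁴` at level `2` and the ceiling
  `‖T‖² = 10⁻⁴⁰` of all of them.
* §F THE READING, in any Hilbert space (`exists_nonCyclic_near_of_indepRunD`): `IndepRunD` at an admissible start
  forces a non-zero NON-CYCLIC vector within `0.7` of `x₀`.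

READING FOR THE GAP.  The hypotheses the text names for (34)-along-the-construction — type 1 with `u₀`,
`‖T‖ = 10⁻²⁰`, the window, the start margin, `(εθ)₀ > 0`, a cyclic `y₀`, ONE modulus `σ` in the `δ₂`-range — do
not imply it: what the endgame needs is a non-cyclic vector WITHIN `0.7` OF `x₀`, and whether one exists is a
property of the pair `(T, x₀)` that none of those hypotheses controls (the consistent orbit of R32/R33 has
`x₀ = 0.8u₀ + 0.6u₁`, `0.6`-close to the eigenline `ℂu₀`).  Under `¬NIS` — the situation of the refused goal G3 —
NO `x₀` is close to a non-cyclic vector.  This neither refutes nor supports the manuscript's theorem; it replaces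
"undecided at `σ = δ₂`" in GAP G4 (iii) by a refutation whose mechanism is independent of `σ`.

Origin: planner-b2b-enflo-2-g22-0 (formaliser 2, gen 22), 2026-08-19.
-/

noncomputable section

open scoped InnerProductSpace ComplexConjugate
open ContinuousLinearMap Filter Topology RCLike

namespace Literature.Analysis.OperatorTheory.Enflo2023

/-! ### A. The located endgame: the chain keeps the limit vector -/

section Located

variable {H : Type*} [NormedAddCommGroup H] [InnerProductSpace ℂ H]

/-- **The located output of the Main Construction's limit step**: a vector `w ≠ 0` (the limit `ℓ_∞(T)y_∞` of the
moved parts) with `0.3 ≤ ‖x₀ − w‖ ≤ 0.7` whose whole orbit is orthogonal to `x₀ − w`; in particular `w` is a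
non-cyclic vector within `0.7` of `x₀`. [cite: Enflo2023, v2 (11) p.4, p.20–22] -/
def HasMCLimit (T : H →L[ℂ] H) (x₀ : H) : Prop :=
  ∃ w : H, w ≠ 0 ∧ (0.3 : ℝ) ≤ ‖x₀ - w‖ ∧ ‖x₀ - w‖ ≤ 0.7 ∧ ∀ j : ℕ, ⟪x₀ - w, (T ^ j) w⟫_ℂ = 0

omit [InnerProductSpace ℂ H] in
/-- `0.3 ≤ ‖x₀ − w‖` makes `x₀ − w ≠ 0`. [folklore] -/
lemma sub_ne_zero_of_window {x₀ w : H} (h : (0.3 : ℝ) ≤ ‖x₀ - w‖) : x₀ - w ≠ 0 := by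
  intro h0; rw [h0, norm_zero] at h; norm_num at h

/-- The located output refines the chain's conclusion: it gives a non-trivial closed invariant subspace
(`Basic.hasNontrivialClosedInvariantSubspace_of_orbit_orthogonal'`). [cite: Enflo2023, v2 (11) p.4] -/
theorem HasMCLimit.hasNontrivialClosedInvariantSubspace {T : H →L[ℂ] H} {x₀ : H} (h : HasMCLimit T x₀) :
    HasNontrivialClosedInvariantSubspace T := by
  obtain ⟨w, hw0, hlo, -, horth⟩ := h
  exact hasNontrivialClosedInvariantSubspace_of_orbit_orthogonal' T hw0 (sub_ne_zero_of_window hlo) horth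

/-- v2 (11), located: a norm-convergent MC output gives the located limit (same proof as
`LimitStep.hasNontrivialClosedInvariantSubspace_of_norm_convergent_MC`, witness kept). [cite: Enflo2023, v2 (11) p.4] -/
theorem hasMCLimit_of_norm_convergent_MC (T : H →L[ℂ] H) (x₀ : H) (w : ℕ → H) (wlim : H) (ε : ℕ → ℝ)
    (hx₀ : ‖x₀‖ = 1) (hdist : ∀ n, 0.3 ≤ ‖x₀ - w n‖ ∧ ‖x₀ - w n‖ ≤ 0.7)
    (hw : Tendsto w atTop (𝓝 wlim)) (hε : Tendsto ε atTop (𝓝 0))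
    (h : ∀ n j, ‖⟪x₀ - w n, (T ^ j) (w n)⟫_ℂ‖ ≤ ε n) : HasMCLimit T x₀ := by
  have horth := orbit_orthogonal_of_norm_limit T x₀ w wlim ε hw hε h
  have hd : Tendsto (fun n => ‖x₀ - w n‖) atTop (𝓝 ‖x₀ - wlim‖) :=
    ((continuous_const.sub continuous_id).norm.tendsto wlim).comp hw
  have hle : ‖x₀ - wlim‖ ≤ 0.7 := le_of_tendsto' hd fun n => (hdist n).2
  have hge : (0.3 : ℝ) ≤ ‖x₀ - wlim‖ := ge_of_tendsto' hd fun n => (hdist n).1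
  exact ⟨wlim, ne_zero_of_norm_sub_lt_one hx₀ (by linarith), hge, hle, horth⟩

/-- Rooms `→ 0` give the located limit (as `hasNontrivialClosedInvariantSubspace_of_rooms`). [cite: Enflo2023, v2 p.20, after (46)] -/
theorem hasMCLimit_of_rooms [CompleteSpace H] (T : H →L[ℂ] H) (x₀ : H) (hx₀ : ‖x₀‖ = 1) (v : ℕ → H)
    (εθ : ℕ → ℝ) (hnorm : ∀ n, (0.3 : ℝ) ≤ ‖v n‖ ∧ ‖v n‖ ≤ 0.7)
    (h9 : ∀ n j, ‖⟪v n, (T ^ j) (x₀ - v n)⟫_ℂ‖ ≤ εθ n) (hεθ : Tendsto εθ atTop (𝓝 0))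
    (p : ℕ → ℕ) (ρ : ℕ → ℝ) (hroom : ∀ k n, p k ≤ n → ‖v n - v (p k)‖ ≤ ρ k)
    (hρ : Tendsto ρ atTop (𝓝 0)) : HasMCLimit T x₀ := by
  obtain ⟨vlim, hv⟩ := cauchySeq_tendsto_of_complete (cauchySeq_of_rooms v p ρ hroom hρ)
  have hw : Tendsto (fun n => x₀ - v n) atTop (𝓝 (x₀ - vlim)) := tendsto_const_nhds.sub hv
  refine hasMCLimit_of_norm_convergent_MC T x₀ (fun n => x₀ - v n) (x₀ - vlim) εθ hx₀ (fun n => ?_) hw hεθ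
    (fun n j => ?_)
  · simpa using hnorm n
  · simpa using h9 n j

end Located

namespace Eq45

open PivotRoom

variable {H : Type*} [NormedAddCommGroup H] [InnerProductSpace ℂ H]

/-- The type-1 endgame with an arbitrary drift constant, located (as
`Eq45.hasNontrivialClosedInvariantSubspace_of_repivoting_C`). [cite: Enflo2023, v2 pp.19–21, (45)–(46)] -/
theorem hasMCLimit_of_repivoting_C [CompleteSpace H] (T : H →L[ℂ] H)
    (x₀ : H) (hx₀ : ‖x₀‖ = 1) (v : ℕ → H) (εθ : ℕ → ℝ) (β C : ℝ) (hC : 0 ≤ C)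
    (hnorm : ∀ n, (0.3 : ℝ) ≤ ‖v n‖ ∧ ‖v n‖ ≤ 0.7)
    (h9 : ∀ n j, ‖⟪v n, (T ^ j) (x₀ - v n)⟫_ℂ‖ ≤ εθ n)
    (hid : ∀ m, (εθ m : ℂ) = ⟪v m, x₀ - v m⟫_ℂ) (hpos : ∀ n, 0 ≤ εθ n) (hanti : Antitone εθ)
    (hlim : Tendsto εθ atTop (𝓝 0))
    (h45 : ∀ k, |re ⟪x₀, v (k + 1) - v k⟫_ℂ| ≤ C * β * εθ k)
    (hratio : ∀ k, εθ (k + 1) ≤ (1 - β) * εθ k)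
    (p : ℕ → ℕ) (hp : StrictMono p) (c : ℕ → H) (g : ℕ → ℝ) (hc0 : ∀ i, c i ≠ 0)
    (hg : ∀ i, 0 ≤ g i)
    (hang : ∀ i, ‖((‖x₀ - v (p i)‖ : ℝ) : ℂ) • c i - ((‖c i‖ : ℝ) : ℂ) • (x₀ - v (p i))‖
      ≤ g i * (‖c i‖ * ‖x₀ - v (p i)‖))
    (hc : ∀ i k, p i ≤ k → k < p (i + 1) → ⟪c i, v (k + 1) - v k⟫_ℂ = 0)
    (hsum : Summable (fun i => 2 * g i + Real.sqrt ((1 + C) * εθ (p i)))) :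
    HasMCLimit T x₀ :=
  hasMCLimit_of_rooms T x₀ hx₀ v εθ hnorm h9 hlim p
    (fun i => ∑' m, (2 * g (m + i) + Real.sqrt ((1 + C) * εθ (p (m + i)))))
    (fun i _ hin => room_le_tsum_of_epochs (r := fun i => 2 * g i + Real.sqrt ((1 + C) * εθ (p i))) hp
      (fun i => add_nonneg (by linarith [hg i]) (Real.sqrt_nonneg _)) hsum
      (fun i _ hin hni => epoch_room_C hC hx₀ hid hpos hanti h45 hratio (hc0 i) (hg i) (hang i) (hc i) hin hni)
      hin)
    (tendsto_sum_nat_add (fun i => 2 * g i + Real.sqrt ((1 + C) * εθ (p i))))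

end Eq45

namespace MCStep

section AbstractLocated

variable {H : Type*} [NormedAddCommGroup H] [InnerProductSpace ℂ H]

/-- The endgame of an abstract step system, located (as `StepSystem.nis`). [cite: Enflo2023, v2 p.17–20, (40), (45)–(47), p.22 (11)] -/
theorem StepSystem.hasMCLimit {σ : Type*} (𝔖 : StepSystem H σ) [CompleteSpace H] (T : H →L[ℂ] H)
    (hx₀ : ‖𝔖.x₀‖ = 1) (hwin : ∀ s : σ, (0.3 : ℝ) ≤ ‖𝔖.v s‖ ∧ ‖𝔖.v s‖ ≤ 0.7)
    (h9 : ∀ (s : σ) (j : ℕ), ‖⟪𝔖.v s, (T ^ j) (𝔖.x₀ - 𝔖.v s)⟫_ℂ‖ ≤ 𝔖.e s)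
    (hid : ∀ s : σ, ((𝔖.e s : ℝ) : ℂ) = ⟪𝔖.v s, 𝔖.x₀ - 𝔖.v s⟫_ℂ) : HasMCLimit T 𝔖.x₀ :=
  Eq45.hasMCLimit_of_repivoting_C T 𝔖.x₀ hx₀ 𝔖.vt 𝔖.et 𝔖.β 𝔖.C 𝔖.hC
    (fun _ => hwin _) (fun _ j => h9 _ j) (fun _ => hid _)
    𝔖.et_nonneg 𝔖.et_antitone 𝔖.et_tendsto 𝔖.drift_succ 𝔖.et_succ_le
    𝔖.pt 𝔖.pt_strictMono 𝔖.wt 𝔖.gt (fun _ => 𝔖.w_ne_zero _) (fun _ => 𝔖.hG0 _)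
    𝔖.wt_angle 𝔖.side_epoch 𝔖.summable_rooms

end AbstractLocated

variable {E H : Type*} [NormedAddCommGroup E] [InnerProductSpace ℂ E] [CompleteSpace E]
  [NormedAddCommGroup H] [InnerProductSpace ℂ H] [CompleteSpace H]

/-- The endgame from the restricted claim, located (as `MCStep.nis_of_claimG`). [cite: Enflo2023, v2 p.17–20, (40), (45)–(47), (11)] -/
theorem hasMCLimit_of_claimG (T : H →L[ℂ] H) (x₀ : H) (hx₀ : ‖x₀‖ = 1) (S : E →L[ℂ] E) (hS : ‖S‖ ≤ 1)
    {C β : ℝ} (hC : 0 ≤ C) (hβ : 0 < β) (hβ1 : β ≤ 1) (G : ℝ → ℝ) (hG0 : ∀ x, 0 ≤ G x)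
    (hG : ∀ η : ℝ, 0 < η → ∃ δ : ℝ, 0 < δ ∧ ∀ x, 0 ≤ x → x ≤ δ → G x ≤ η)
    {Good : State T x₀ S → Prop} (hclaim : ClaimG T x₀ S C β G Good) (s₀ : State T x₀ S) (h₀ : Good s₀) :
    HasMCLimit T x₀ :=
  (systemOfClaimG hx₀ hS hC hβ hβ1 hG0 hG hclaim s₀ h₀).hasMCLimit T hx₀ (fun s => s.1.window hx₀)
    (fun s j => s.1.h9 hx₀ hS j) (fun s => s.1.hid hx₀)

end MCStep

namespace StepRealisation

open MCStep

section OrbitLocated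

variable {E H : Type*} [NormedAddCommGroup E] [InnerProductSpace ℂ E] [CompleteSpace E]
  [NormedAddCommGroup H] [InnerProductSpace ℂ H] [CompleteSpace H]
variable {T : H →L[ℂ] H} {x₀ : H} {S : E →L[ℂ] E}
variable {P : Type*} [NormedAddCommGroup P] [NormedSpace ℝ P]

/-- **Orbit-level independence ⟹ the located limit** (as `nis_of_indepRunD`, any ratio `0 < β ≤ σ²/1000`): an
admissible start at which `IndepRunD` holds yields a NON-CYCLIC vector `w` with `0.3 ≤ ‖x₀ − w‖ ≤ 0.7`.
[cite: Enflo2023, v2 (34)–(47), p.16–20; p.22 (11)] -/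
theorem hasMCLimit_of_indepRunD [CompleteSpace P] (T : H →L[ℂ] H) (x₀ : H) (hx₀ : ‖x₀‖ = 1) (S : E →L[ℂ] E)
    (hS : ‖S‖ ≤ 1) {ι : P →+ (E →L[ℂ] E)} (hιs : ∀ (t : ℝ) (p : P), ι (t • p) = (t : ℂ) • ι p)
    (hι1 : ∀ p, ‖ι p‖ ≤ ‖p‖) (hιS : ∀ p, ι p ∘L S = S ∘L ι p) {σ β : ℝ} (hσ : 0 < σ) (hσ1 : σ ≤ 1)
    (hβ0 : 0 < β) (hβ : β ≤ σ ^ 2 / 1000) (s₀ : State T x₀ S)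
    (hstart : (0.09 : ℝ) + (22 / σ + 1) * s₀.etheta ≤ s₀.ε ^ 2 ∧
      s₀.ε ^ 2 + (22 / σ + 1) * s₀.etheta ≤ 0.49)
    (h : IndepRunD T x₀ S ι σ β s₀) : HasMCLimit T x₀ := by
  have hσ2 : σ ^ 2 ≤ 1 := pow_le_one₀ hσ.le hσ1
  have hβ1 : β ≤ 1 := by linarith
  have hC : (0 : ℝ) ≤ 22 / σ := by positivity
  exact hasMCLimit_of_claimG T x₀ hx₀ S hS hC hβ0 hβ1 (fun _ => 0) (fun _ => le_rfl)
    (fun η hη => ⟨1, one_pos, fun _ _ _ => hη.le⟩)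
    (claimG_of_indepRunD hx₀ hS hιs hι1 hιS hσ hσ1 hβ0.le hβ (fun _ => 0) (fun _ => le_rfl) s₀ hstart h)
    s₀ ReachD.start

end OrbitLocated

/-! ### B. The model `T = w₀P₀ + τJ` on `ℂ³`: type 1, `‖T‖ = w₀`, and far vectors stay far -/

open Vy DiagN
open Lemma1.Standing (e e_apply norm_e inner_e_left)

namespace Far

/-- `ℂ³` (as `EuclideanSpace ℂ (Fin 3)`). [folklore] -/
abbrev C3 : Type := Cd 3

variable {w₀ τ α : ℝ}

/-- THE MODEL OPERATOR `T_{w₀,τ} : (v₀, v₁, v₂) ↦ (w₀v₀, 0, τv₁)` on `ℂ³` — an eigenvalue `w₀` at `e₀` plus a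
weighted nilpotent Jordan block `u₁ ↦ τu₂ ↦ 0`. [cite: Enflo2023, v2 p.6 (type 1), p.1 (`‖T‖ = 10⁻²⁰`)] -/
def TF (w₀ τ : ℝ) : C3 →L[ℂ] C3 :=
  ((w₀ : ℝ) : ℂ) • (EuclideanSpace.proj (0 : Fin 3) : C3 →L[ℂ] ℂ).smulRight (u 0) +
    ((τ : ℝ) : ℂ) • (EuclideanSpace.proj (1 : Fin 3) : C3 →L[ℂ] ℂ).smulRight (u 2)

/-- `T v = (w₀v₀)u₀ + (τv₁)u₂`. [folklore] -/
lemma TF_apply_eq (v : C3) :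
    TF w₀ τ v = (((w₀ : ℝ) : ℂ) * v 0) • u 0 + (((τ : ℝ) : ℂ) * v 1) • u 2 := by
  simp only [TF, _root_.add_apply, _root_.smul_apply, ContinuousLinearMap.smulRight_apply, smul_smul]
  rfl

/-- `(T v)₀ = w₀v₀`. [folklore] -/
@[simp] lemma TF_apply_zero (v : C3) : TF w₀ τ v 0 = ((w₀ : ℝ) : ℂ) * v 0 := by
  rw [TF_apply_eq, PiLp.add_apply, PiLp.smul_apply, PiLp.smul_apply, u_apply, u_apply]; simp

/-- `(T v)₁ = 0`. [folklore] -/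
@[simp] lemma TF_apply_one (v : C3) : TF w₀ τ v 1 = 0 := by
  rw [TF_apply_eq, PiLp.add_apply, PiLp.smul_apply, PiLp.smul_apply, u_apply, u_apply]; simp

/-- `(T v)₂ = τv₁`. [folklore] -/
@[simp] lemma TF_apply_two (v : C3) : TF w₀ τ v 2 = ((τ : ℝ) : ℂ) * v 1 := by
  rw [TF_apply_eq, PiLp.add_apply, PiLp.smul_apply, PiLp.smul_apply, u_apply, u_apply]; simp

/-- `T u₀ = w₀u₀`. [folklore] -/
lemma TF_u_zero : TF w₀ τ (u 0) = ((w₀ : ℝ) : ℂ) • u 0 := by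
  ext j; fin_cases j <;> simp [u_apply]

/-- `T² v = w₀²v₀·u₀` (the Jordan part dies at the second step). [folklore] -/
lemma TF_TF (v : C3) : TF w₀ τ (TF w₀ τ v) = (((w₀ : ℝ) : ℂ) ^ 2 * v 0) • u 0 := by
  ext j; fin_cases j <;> simp [u_apply]; ring

/-- iterates: `Tʲ⁺²y = w₀ʲ⁺²y₀·u₀`. [folklore] -/
lemma TF_iterate_add_two (y : C3) (j : ℕ) :
    (⇑(TF w₀ τ))^[j + 2] y = (((w₀ : ℝ) : ℂ) ^ (j + 2) * y 0) • u 0 := by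
  induction j with
  | zero =>
    show TF w₀ τ (TF w₀ τ y) = _
    rw [TF_TF]
  | succ j ih =>
    rw [show j + 1 + 2 = (j + 2) + 1 from by ring, Function.iterate_succ_apply', ih, map_smul, TF_u_zero,
      smul_smul]
    congr 1; ring

/-- `⟨Tʲ⁺²y, y⟩ = w₀ʲ⁺²|y₀|²`. [cite: Enflo2023, v2 p.6 (type 1)] -/
lemma inner_TF_iterate_add_two (y : C3) (j : ℕ) :
    ⟪(⇑(TF w₀ τ))^[j + 2] y, y⟫_ℂ = ((w₀ ^ (j + 2) * ‖y 0‖ ^ 2 : ℝ) : ℂ) := by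
  rw [TF_iterate_add_two, inner_smul_left, inner_u_left, map_mul, map_pow, Complex.conj_ofReal, mul_assoc,
    mul_comm (conj (y 0)), Complex.mul_conj, Complex.normSq_eq_norm_sq]
  push_cast; ring

/-- the type-1 inequality with explicit constants: on the cone `Re⟨y/‖y‖, u₀⟩ ≥ 1/100` one has `|y₀| ≥ ‖y‖/100`,
so `|⟨Tⁿ⁺²y, y⟩| = w₀ⁿ⁺²|y₀|² ≥ 10⁻⁴w₀ⁿ⁺²‖y‖²`; `n = 0`: `δ₂ := 10⁻⁴w₀²` is a type-1 constant of `T` at level `2`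
(and every type-1 constant at a level `≥ 2` is `≤ ‖T‖²`, `StepRealisationDiagLow.type1Const_le_opNorm_sq`).
[cite: Enflo2023, v2 p.6 (definition of type 1), p.19 l.656–660] -/
theorem type1_const (hw₀ : 0 ≤ w₀) (n : ℕ) (y : C3) (hy : Referee.AngleCond (u 0) y) :
    w₀ ^ (n + 2) / 10 ^ 4 * ‖y‖ ^ 2 ≤ ‖⟪(⇑(TF w₀ τ))^[n + 2] y, y⟫_ℂ‖ := by
  have hre : (1 / 100 : ℝ) * ‖y‖ ≤ ‖y 0‖ := by
    have h := hy.2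
    rw [inner_u_left] at h
    exact h.trans (RCLike.re_le_norm (y 0))
  have hnn : 0 ≤ w₀ ^ (n + 2) * ‖y 0‖ ^ 2 := by positivity
  rw [inner_TF_iterate_add_two, Complex.norm_real, Real.norm_of_nonneg hnn]
  have h2 : (1 / 100 * ‖y‖) ^ 2 ≤ ‖y 0‖ ^ 2 := pow_le_pow_left₀ (by positivity) hre 2
  have hw2 : 0 ≤ w₀ ^ (n + 2) := by positivity
  nlinarith [mul_le_mul_of_nonneg_left h2 hw2]

/-- **THE MODEL IS OF TYPE 1** (v2 p.6) with `u₀ = e₀`, `δ_n = 10⁻⁴w₀ⁿ⁺²`, `j = n + 2`.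
[cite: Enflo2023, v2 p.6 (definition of type 1)] -/
theorem type1 (hw₀ : 0 < w₀) : Referee.Type1 (TF w₀ τ) :=
  ⟨u 0, norm_u 0, fun n _ =>
    ⟨w₀ ^ (n + 2) / 10 ^ 4, by positivity, fun y hy => ⟨n + 2, by omega, type1_const hw₀.le n y hy⟩⟩⟩

/-- `‖v‖² = |v₀|² + |v₁|² + |v₂|²` on `ℂ³`. [folklore] -/
lemma norm_sq_C3 (v : C3) : ‖v‖ ^ 2 = ‖v 0‖ ^ 2 + ‖v 1‖ ^ 2 + ‖v 2‖ ^ 2 := by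
  rw [EuclideanSpace.norm_sq_eq, Fin.sum_univ_three]

/-- a coordinate is at most the norm. [folklore] -/
lemma norm_apply_le_C3 (v : C3) (i : Fin 3) : ‖v i‖ ≤ ‖v‖ := by
  have h : ‖v i‖ ^ 2 ≤ ‖v‖ ^ 2 := by
    rw [EuclideanSpace.norm_sq_eq]
    exact Finset.single_le_sum (f := fun k => ‖v k‖ ^ 2) (fun k _ => sq_nonneg _) (Finset.mem_univ i)
  exact (pow_le_pow_iff_left₀ (norm_nonneg _) (norm_nonneg _) two_ne_zero).1 h

/-- **`‖T_{w₀,τ}‖ = w₀`** for `0 ≤ τ ≤ w₀` (so `w₀ = 10⁻²⁰` is the standing normalisation `‖T‖ = 10⁻²⁰`).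
[cite: Enflo2023, v2 p.1] -/
theorem opNorm_TF (hw₀ : 0 ≤ w₀) (hτ : 0 ≤ τ) (hτw : τ ≤ w₀) : ‖TF w₀ τ‖ = w₀ := by
  refine le_antisymm (ContinuousLinearMap.opNorm_le_bound _ hw₀ fun v => ?_) ?_
  · have h : ‖TF w₀ τ v‖ ^ 2 ≤ (w₀ * ‖v‖) ^ 2 := by
      rw [norm_sq_C3, mul_pow, norm_sq_C3, TF_apply_zero, TF_apply_one, TF_apply_two, norm_mul, norm_mul,
        norm_zero, Complex.norm_real, Complex.norm_real, Real.norm_of_nonneg hw₀, Real.norm_of_nonneg hτ]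
      have h1 : (τ * ‖v 1‖) ^ 2 ≤ (w₀ * ‖v 1‖) ^ 2 :=
        pow_le_pow_left₀ (by positivity) (mul_le_mul_of_nonneg_right hτw (norm_nonneg _)) 2
      nlinarith [sq_nonneg (w₀ * ‖v 2‖), sq_nonneg (w₀ * ‖v 0‖)]
    exact (pow_le_pow_iff_left₀ (norm_nonneg _) (by positivity) two_ne_zero).1 h
  · have h := (TF w₀ τ).le_opNorm (u 0)
    rw [TF_u_zero, norm_smul, norm_u, Complex.norm_real, Real.norm_of_nonneg hw₀, mul_one, mul_one] at h
    exact h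

/-- **FAR VECTORS STAY FAR.**  The non-trivial invariant subspaces of `T_{w₀,τ}` (`w₀, τ ≠ 0`) are
`ℂu₀, ℂu₂, ℂu₁ ⊕ ℂu₂, ℂu₀ ⊕ ℂu₂`; a vector `x₀` with `|x₀,₀| > m` and `|x₀,₁| > m` is more than `m` away from all of
them.  In the form the endgame produces: if `x₀ ≠ w` and `x₀ − w ⊥ w, Tw, T²w`, then `‖x₀ − w‖ > m`
(indeed `x₀ − w ∈ {(0,q,r), (0,q,0), (p,q,0), (p,0,0)}`-shaped, coordinates of `x₀`). [folklore] -/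
theorem lt_norm_sub_of_orbit_orthogonal (hw₀ : w₀ ≠ 0) (hτ : τ ≠ 0) {x₀ w : C3} {m : ℝ}
    (hp : m < ‖x₀ 0‖) (hq : m < ‖x₀ 1‖) (hu : x₀ - w ≠ 0) (h0 : ⟪x₀ - w, w⟫_ℂ = 0)
    (h1 : ⟪x₀ - w, TF w₀ τ w⟫_ℂ = 0) (h2 : ⟪x₀ - w, TF w₀ τ (TF w₀ τ w)⟫_ℂ = 0) : m < ‖x₀ - w‖ := by
  have hw₀' : ((w₀ : ℝ) : ℂ) ≠ 0 := by exact_mod_cast hw₀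
  have hτ' : ((τ : ℝ) : ℂ) ≠ 0 := by exact_mod_cast hτ
  -- the three orthogonality relations in coordinates
  have e2 : conj (x₀ 0 - w 0) * w 0 = 0 := by
    rw [TF_TF, inner_smul_right, inner_u_right, PiLp.sub_apply] at h2
    have h2' : conj (x₀ 0 - w 0) * w 0 * ((w₀ : ℝ) : ℂ) ^ 2 = 0 := by
      rw [← h2]; ring
    exact (mul_eq_zero.1 h2').resolve_right (pow_ne_zero 2 hw₀')
  have e1 : conj (x₀ 0 - w 0) * w 0 * ((w₀ : ℝ) : ℂ) + conj (x₀ 2 - w 2) * w 1 * ((τ : ℝ) : ℂ) = 0 := by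
    rw [PiLp.inner_apply, Fin.sum_univ_three] at h1
    simp only [PiLp.sub_apply, TF_apply_zero, TF_apply_one, TF_apply_two, inner_zero_right, add_zero] at h1
    rw [← h1]
    simp only [RCLike.inner_apply']
    ring
  have e0 : conj (x₀ 0 - w 0) * w 0 + conj (x₀ 1 - w 1) * w 1 + conj (x₀ 2 - w 2) * w 2 = 0 := by
    rw [PiLp.inner_apply, Fin.sum_univ_three] at h0
    rw [← h0]
    simp only [PiLp.sub_apply, RCLike.inner_apply']
  -- a coordinate of `x₀ − w` equal to a coordinate of `x₀` exceeding `m` suffices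
  have key : ∀ i, w i = 0 → m < ‖x₀ i‖ → m < ‖x₀ - w‖ := fun i hi hm =>
    lt_of_lt_of_le (by rw [PiLp.sub_apply, hi, sub_zero]; exact hm) (norm_apply_le_C3 (x₀ - w) i)
  rcases mul_eq_zero.1 e2 with ha | ha
  · -- `a = p`
    have hpa : x₀ 0 - w 0 = 0 := (map_eq_zero _).1 ha
    rw [hpa, map_zero, zero_mul, zero_mul, zero_add] at e1
    have e1' : conj (x₀ 2 - w 2) * w 1 = 0 := (mul_eq_zero.1 e1).resolve_right hτ'
    rcases mul_eq_zero.1 e1' with hc | hb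
    · -- `c = r`
      have hrc : x₀ 2 - w 2 = 0 := (map_eq_zero _).1 hc
      rw [hpa, hrc, map_zero, zero_mul, zero_mul, zero_add, add_zero] at e0
      rcases mul_eq_zero.1 e0 with hb' | hb
      · -- `b = q`: then `x₀ = w`, excluded
        have hqb : x₀ 1 - w 1 = 0 := (map_eq_zero _).1 hb'
        refine absurd ?_ hu
        ext i
        fin_cases i
        · simpa using hpa
        · simpa using hqb
        · simpa using hrc
      · exact key 1 hb hq
    · exact key 1 hb hq
  · exact key 0 ha hp

/-- **CYCLIC VECTORS of `T_{w₀,τ}`** (`w₀, τ ≠ 0`): every `y` with `y₀ ≠ 0`, `y₁ ≠ 0` is cyclic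
(`T²y = w₀²y₀u₀`, `Ty − w₀y₀u₀ = τy₁u₂`, and then `y` supplies `u₁`). [cite: Enflo2023, v2 p.3 ("then `y₀` is non-cyclic")] -/
theorem cyclic_of_ne (hw₀ : w₀ ≠ 0) (hτ : τ ≠ 0) {y : C3} (h0 : y 0 ≠ 0) (h1 : y 1 ≠ 0) :
    ¬ IsNonCyclic (TF w₀ τ) y := by
  have hw₀' : ((w₀ : ℝ) : ℂ) ≠ 0 := by exact_mod_cast hw₀
  have hτ' : ((τ : ℝ) : ℂ) ≠ 0 := by exact_mod_cast hτ
  intro hnc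
  apply hnc
  rw [orbitClosure, eq_top_iff]
  set M : Submodule ℂ C3 := Submodule.span ℂ (Set.range fun j : ℕ => (TF w₀ τ ^ j) y) with hM
  have hy : y ∈ M := Submodule.subset_span ⟨0, by dsimp only; rw [pow_zero, one_apply_eq_self]⟩
  have hTy : TF w₀ τ y ∈ M := Submodule.subset_span ⟨1, by dsimp only; rw [pow_one]⟩
  have hT2y : TF w₀ τ (TF w₀ τ y) ∈ M := by
    have h : (TF w₀ τ ^ 2) y ∈ M := Submodule.subset_span ⟨2, rfl⟩
    simpa [pow_succ] using h
  -- `u₀ ∈ M`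
  have hc0 : ((w₀ : ℝ) : ℂ) ^ 2 * y 0 ≠ 0 := mul_ne_zero (pow_ne_zero 2 hw₀') h0
  have hu0 : u 0 ∈ M := by
    have hm : (((w₀ : ℝ) : ℂ) ^ 2 * y 0) • u 0 ∈ M := by rw [← TF_TF]; exact hT2y
    have := M.smul_mem ((((w₀ : ℝ) : ℂ) ^ 2 * y 0))⁻¹ hm
    rwa [smul_smul, inv_mul_cancel₀ hc0, one_smul] at this
  -- `u₂ ∈ M`
  have hc2 : ((τ : ℝ) : ℂ) * y 1 ≠ 0 := mul_ne_zero hτ' h1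
  have hu2 : u 2 ∈ M := by
    have hm : (((τ : ℝ) : ℂ) * y 1) • u 2 ∈ M := by
      have h : (((τ : ℝ) : ℂ) * y 1) • u 2 = TF w₀ τ y - (((w₀ : ℝ) : ℂ) * y 0) • u 0 := by
        rw [TF_apply_eq, add_sub_cancel_left]
      rw [h]; exact M.sub_mem hTy (M.smul_mem _ hu0)
    have := M.smul_mem ((((τ : ℝ) : ℂ) * y 1))⁻¹ hm
    rwa [smul_smul, inv_mul_cancel₀ hc2, one_smul] at this
  -- `u₁ ∈ M`
  have hu1 : u 1 ∈ M := by
    have hm : (y 1) • u 1 ∈ M := by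
      have h : (y 1) • u 1 = y - (y 0) • u 0 - (y 2) • u 2 := by
        ext i; fin_cases i <;> simp [u_apply]
      rw [h]; exact M.sub_mem (M.sub_mem hy (M.smul_mem _ hu0)) (M.smul_mem _ hu2)
    have := M.smul_mem (y 1)⁻¹ hm
    rwa [smul_smul, inv_mul_cancel₀ h1, one_smul] at this
  intro v _
  apply M.le_topologicalClosure
  rw [decomp_u v, Fin.sum_univ_three]
  exact M.add_mem (M.add_mem (M.smul_mem _ hu0) (M.smul_mem _ hu1)) (M.smul_mem _ hu2)

/-! ### C. Over a far `x₀` the orbit residual fails for every start, every modulus and every ratio -/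

/-- **`IndepRunD` FAILS OVER A FAR `x₀`, WHATEVER THE MODULUS.**  In the model `T_{w₀,τ}` (`w₀, τ ≠ 0`), for a
unit `x₀` with `|x₀,₀| > 0.7` and `|x₀,₁| > 0.7`, EVERY true MC start `s₀` over `x₀` with the run's start margin
refutes `IndepRunD T x₀ S (ιS S) σ β s₀`, for every `0 < σ ≤ 1` and `0 < β ≤ σ²/1000`: the endgame it drives
(`hasMCLimit_of_indepRunD`) would produce a non-cyclic `w` with `‖x₀ − w‖ ≤ 0.7`, and there is none
(`lt_norm_sub_of_orbit_orthogonal`).  The modulus enters nowhere. [cite: Enflo2023, v2 (34) p.16; p.19 l.655–677; (11) p.4] -/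
theorem not_indepRunD_of_far (hw₀ : w₀ ≠ 0) (hτ : τ ≠ 0) {x₀ : C3} (hx₀ : ‖x₀‖ = 1) (hp : 0.7 < ‖x₀ 0‖)
    (hq : 0.7 < ‖x₀ 1‖) {σ β : ℝ} (hσ : 0 < σ) (hσ1 : σ ≤ 1) (hβ0 : 0 < β) (hβ : β ≤ σ ^ 2 / 1000)
    (s₀ : State (TF w₀ τ) x₀ S)
    (hstart : (0.09 : ℝ) + (22 / σ + 1) * s₀.etheta ≤ s₀.ε ^ 2 ∧
      s₀.ε ^ 2 + (22 / σ + 1) * s₀.etheta ≤ 0.49) :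
    ¬ IndepRunD (TF w₀ τ) x₀ S (ιS S) σ β s₀ := by
  intro h
  obtain ⟨hιs, hι1, hιS⟩ := ιS_props (Vy.S)
  obtain ⟨w, -, hlo, hhi, horth⟩ :=
    hasMCLimit_of_indepRunD (TF w₀ τ) x₀ hx₀ S norm_S_le hιs hι1 hιS hσ hσ1 hβ0 hβ s₀ hstart h
  have h0 : ⟪x₀ - w, w⟫_ℂ = 0 := by simpa using horth 0
  have h1 : ⟪x₀ - w, TF w₀ τ w⟫_ℂ = 0 := by simpa using horth 1
  have h2 : ⟪x₀ - w, TF w₀ τ (TF w₀ τ w)⟫_ℂ = 0 := by simpa [pow_succ] using horth 2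
  have hlt := lt_norm_sub_of_orbit_orthogonal hw₀ hτ hp hq (sub_ne_zero_of_window hlo) h0 h1 h2
  linarith

/-! ### D. Non-vacuity at the text's modulus: an admissible, non-degenerate far start (bracket form) -/

/-- THE MODEL INTERTWINERS for `τ = α²`: `W_α b = (c₀⟪g_{w₀}, b⟫, b₀/α, (α − 1/α)b₀ + αb₁)`, `c₀ = 2/(α(1 + w₀))`
(`W_α = V_y` for `y = W_αe₀ = (c₀, 1/α, α − 1/α)`). [cite: Enflo2023, v2 (2)–(4) p.2] -/
def WF (w₀ α : ℝ) : ℓ2 →L[ℂ] C3 :=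
  ((2 / (α * (1 + w₀)) : ℝ) : ℂ) • (innerSL ℂ (Diag.gv w₀)).smulRight (u 0) +
    ((1 / α : ℝ) : ℂ) • (innerSL ℂ (e 0)).smulRight (u 1) +
    ((α - 1 / α : ℝ) : ℂ) • (innerSL ℂ (e 0)).smulRight (u 2) +
    ((α : ℝ) : ℂ) • (innerSL ℂ (e 1)).smulRight (u 2)

/-- `W_α b` expanded. [folklore] -/
lemma WF_apply_eq (b : ℓ2) : WF w₀ α b =
    (((2 / (α * (1 + w₀)) : ℝ) : ℂ) * ⟪Diag.gv w₀, b⟫_ℂ) • u 0 + (((1 / α : ℝ) : ℂ) * b 0) • u 1 +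
      (((α - 1 / α : ℝ) : ℂ) * b 0) • u 2 + (((α : ℝ) : ℂ) * b 1) • u 2 := by
  simp only [WF, _root_.add_apply, _root_.smul_apply, ContinuousLinearMap.smulRight_apply, innerSL_apply_apply,
    inner_e_left, smul_smul]

/-- `(W_α b)₀ = c₀⟪g, b⟫`. [folklore] -/
@[simp] lemma WF_apply_zero (b : ℓ2) :
    WF w₀ α b 0 = ((2 / (α * (1 + w₀)) : ℝ) : ℂ) * ⟪Diag.gv w₀, b⟫_ℂ := by
  rw [WF_apply_eq]; simp [u_apply]

/-- `(W_α b)₁ = b₀/α`. [folklore] -/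
@[simp] lemma WF_apply_one (b : ℓ2) : WF w₀ α b 1 = ((1 / α : ℝ) : ℂ) * b 0 := by
  rw [WF_apply_eq]; simp [u_apply]

/-- `(W_α b)₂ = (α − 1/α)b₀ + αb₁`. [folklore] -/
@[simp] lemma WF_apply_two (b : ℓ2) :
    WF w₀ α b 2 = ((α - 1 / α : ℝ) : ℂ) * b 0 + ((α : ℝ) : ℂ) * b 1 := by
  rw [WF_apply_eq]; simp [u_apply]

/-- `W_α` INTERTWINES: `W_α S = T_{w₀,α²} W_α`. [cite: Enflo2023, v2 (2)–(4) p.2] -/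
lemma WF_intertwine (hw : |w₀| < 1) (hα : α ≠ 0) (b : ℓ2) : WF w₀ α (S b) = TF w₀ (α ^ 2) (WF w₀ α b) := by
  have hα' : ((α : ℝ) : ℂ) ≠ 0 := by exact_mod_cast hα
  have hS1 : (S b) 1 = b 0 := S_apply_succ b 0
  ext j
  fin_cases j
  · simp [Diag.inner_gv_S hw]; ring
  · simp
  · simp only [Fin.reduceFinMk, WF_apply_two, S_apply_zero, mul_zero, zero_add, hS1, TF_apply_two, WF_apply_one,
      Fin.isValue]
    push_cast
    field_simp

/-- `W_α†` in coordinates: `W_α† x = (c₀x₀)·g_{w₀} + (x₁/α + (α − 1/α)x₂)·e₀ + (αx₂)·e₁`.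
[cite: Enflo2023, v2 (4) p.2] -/
lemma adjoint_WF (x : C3) : adjoint (WF w₀ α) x =
    (((2 / (α * (1 + w₀)) : ℝ) : ℂ) * x 0) • Diag.gv w₀ +
      (((1 / α : ℝ) : ℂ) * x 1 + ((α - 1 / α : ℝ) : ℂ) * x 2) • e 0 + (((α : ℝ) : ℂ) * x 2) • e 1 := by
  refine ext_inner_right ℂ fun b => ?_
  rw [adjoint_inner_left, PiLp.inner_apply, Fin.sum_univ_three, WF_apply_zero, WF_apply_one, WF_apply_two]
  simp only [inner_add_left, inner_smul_left, inner_e_left, RCLike.inner_apply', map_mul, map_add,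
    Complex.conj_ofReal]
  ring

/-- the bracket seed `ẑ = u₁ + u₂`. [folklore] -/
def zh : C3 := u 1 + u 2

/-- the bracket vector `X̂ = (2, 2, 2α²)`. [folklore] -/
def Xh (α : ℝ) : C3 := (2 : ℂ) • u 0 + (2 : ℂ) • u 1 + ((2 * α ^ 2 : ℝ) : ℂ) • u 2

/-- `ẑ₀ = 0`. [folklore] -/
@[simp] lemma zh_apply_zero : zh 0 = 0 := by simp [zh, u_apply]
/-- `ẑ₁ = 1`. [folklore] -/
@[simp] lemma zh_apply_one : zh 1 = 1 := by simp [zh, u_apply]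
/-- `ẑ₂ = 1`. [folklore] -/
@[simp] lemma zh_apply_two : zh 2 = 1 := by simp [zh, u_apply]
/-- `X̂₀ = 2`. [folklore] -/
@[simp] lemma Xh_apply_zero : Xh α 0 = 2 := by simp [Xh, u_apply]
/-- `X̂₁ = 2`. [folklore] -/
@[simp] lemma Xh_apply_one : Xh α 1 = 2 := by simp [Xh, u_apply]
/-- `X̂₂ = 2α²`. [folklore] -/
@[simp] lemma Xh_apply_two : Xh α 2 = ((2 * α ^ 2 : ℝ) : ℂ) := by simp [Xh, u_apply]

/-- `‖ẑ‖² = 2`. [folklore] -/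
lemma norm_zh_sq : ‖zh‖ ^ 2 = 2 := by
  rw [norm_sq_C3, zh_apply_zero, zh_apply_one, zh_apply_two]; simp; norm_num

/-- `‖X̂‖² = 8 + 4α⁴`. [folklore] -/
lemma norm_Xh_sq : ‖Xh α‖ ^ 2 = 8 + 4 * α ^ 4 := by
  rw [norm_sq_C3, Xh_apply_zero, Xh_apply_one, Xh_apply_two, Complex.norm_real, Real.norm_eq_abs, sq_abs]
  norm_num; ring

/-- `W_α†ẑ = α(e₀ + e₁)`. [folklore] -/
lemma adjoint_WF_zh : adjoint (WF w₀ α) zh = ((α : ℝ) : ℂ) • e 0 + ((α : ℝ) : ℂ) • e 1 := by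
  have hc : ((1 / α : ℝ) : ℂ) * 1 + ((α - 1 / α : ℝ) : ℂ) * 1 = ((α : ℝ) : ℂ) := by push_cast; ring
  rw [adjoint_WF, zh_apply_zero, zh_apply_one, zh_apply_two, hc, mul_zero, zero_smul, zero_add, mul_one]

/-- `‖α(e₀ + e₁)‖² = 2α²`. [folklore] -/
lemma norm_ae_sq : ‖((α : ℝ) : ℂ) • e 0 + ((α : ℝ) : ℂ) • e 1‖ ^ 2 = 2 * α ^ 2 := by
  have h01 : ‖e 0 + e 1‖ ^ 2 = 2 := by
    rw [@norm_add_sq ℂ, inner_e_left, e_apply, norm_e, norm_e]; norm_num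
  rw [← smul_add, norm_smul, mul_pow, h01, Complex.norm_real, Real.norm_eq_abs, sq_abs]; ring

/-- THE BRACKET: `ẑ + W_αW_α†ẑ = (2, 2, 2α²)` (uses `αc₀(1 + w₀) = 2`). [cite: Enflo2023, v2 (5) p.3] -/
lemma bracket_zh (hw : |w₀| < 1) (hα : α ≠ 0) : zh + WF w₀ α (adjoint (WF w₀ α) zh) = Xh α := by
  have hα' : ((α : ℝ) : ℂ) ≠ 0 := by exact_mod_cast hα
  have h1w : (1 : ℂ) + ((w₀ : ℝ) : ℂ) ≠ 0 := by
    have : (0 : ℝ) < 1 + w₀ := by linarith [(abs_lt.1 hw).1]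
    exact_mod_cast this.ne'
  have hg0 : ⟪Diag.gv w₀, e 0⟫_ℂ = 1 := by rw [Diag.inner_gv_e hw 0, pow_zero]
  have hg1 : ⟪Diag.gv w₀, e 1⟫_ℂ = (w₀ : ℂ) := by rw [Diag.inner_gv_e hw 1, pow_one]
  rw [adjoint_WF_zh, map_add, map_smul, map_smul]
  ext j
  fin_cases j
  · simp only [Fin.zero_eta, Fin.isValue, PiLp.add_apply, PiLp.smul_apply, zh_apply_zero, WF_apply_zero, hg0, hg1,
      smul_eq_mul, Xh_apply_zero]
    push_cast
    field_simp
    ring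
  · simp only [Fin.mk_one, Fin.isValue, PiLp.add_apply, PiLp.smul_apply, zh_apply_one, WF_apply_one, e_apply,
      smul_eq_mul, Xh_apply_one]
    push_cast
    field_simp
    norm_num
  · simp only [Fin.reduceFinMk, PiLp.add_apply, PiLp.smul_apply, zh_apply_two, WF_apply_two, e_apply, smul_eq_mul,
      Xh_apply_two, Fin.isValue]
    push_cast
    field_simp
    ring

/-- window arithmetic. [folklore] -/
lemma window_of_sq' {t : ℝ} (ht : 0 < t) (h1 : 0.09 ≤ t ^ 2) (h2 : t ^ 2 ≤ 0.49) :
    (0.3 : ℝ) ≤ t ∧ t ≤ 0.7 := by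
  constructor <;> nlinarith

/-- the margin arithmetic of the far start: `α ≤ 1/10` and `(22/σ + 1)α² ≤ 0.23` once `α² ≤ σ/100 ≤ 1/100`.
[folklore] -/
lemma start_arith (hα : 0 < α) {σ : ℝ} (hσ : 0 < σ) (hσ1 : σ ≤ 1) (hασ : α ^ 2 ≤ σ / 100) :
    α ≤ 1 / 10 ∧ (22 / σ + 1) * α ^ 2 ≤ 0.23 := by
  have hα2 : α ^ 2 ≤ 1 / 100 := hασ.trans (by linarith)
  refine ⟨by nlinarith, ?_⟩
  calc (22 / σ + 1) * α ^ 2 ≤ (22 / σ + 1) * (σ / 100) := by gcongr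
    _ = (22 + σ) / 100 := by field_simp
    _ ≤ 0.23 := by linarith

/-- all three coordinates of `y₀ = W_αe₀ = (c₀, 1/α, α − 1/α)` are non-zero (`0 < α < 1`, `|w₀| < 1`); for
`T_{w₀,α²}` such a `y₀` is cyclic (`T²y₀ ∥ u₀`, `Ty₀ − w₀(y₀)₀u₀ ∥ u₂`, then `y₀` itself supplies `u₁`). [folklore] -/
lemma WF_e_zero_apply_ne_zero (hw : |w₀| < 1) (hα : 0 < α) (hα1 : α < 1) (i : Fin 3) : WF w₀ α (e 0) i ≠ 0 := by
  have h1w : (0 : ℝ) < 1 + w₀ := by linarith [(abs_lt.1 hw).1]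
  have hg0 : ⟪Diag.gv w₀, e 0⟫_ℂ = 1 := by rw [Diag.inner_gv_e hw 0, pow_zero]
  have hc2 : α - 1 / α ≠ 0 := by
    have : 1 < 1 / α := by rw [lt_div_iff₀ hα]; linarith
    exact (by linarith : α - 1 / α < 0).ne
  fin_cases i
  · simp only [Fin.zero_eta, Fin.isValue, WF_apply_zero, hg0, mul_one, ne_eq, Complex.ofReal_eq_zero]
    positivity
  · simp only [Fin.mk_one, Fin.isValue, WF_apply_one, e_apply, if_true, mul_one, ne_eq, Complex.ofReal_eq_zero]
    positivity
  · simp only [Fin.reduceFinMk, WF_apply_two, Fin.isValue]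
    rw [e_apply, e_apply, if_pos rfl, if_neg Nat.one_ne_zero, mul_one, mul_zero, add_zero, Ne,
      Complex.ofReal_eq_zero]
    exact hc2

/-- **AN ADMISSIBLE FAR START EXISTS** for `T_{w₀,α²}` (`0 ≤ w₀ < 1`, `0 < α`, `α² ≤ σ/100`, `0 < σ ≤ 1`): a unit
`x₀ = (1, 1, α²)/√(2 + α⁴)` with `|x₀,₀|, |x₀,₁| > 0.7` and a TRUE MC state `s₀` of the intertwiner `W_α` over it with
`ε² = 1/(4 + 2α⁴)`, `(εθ)₀ = α²/(4 + 2α⁴) > 0` and the run's start margin `(22/σ + 1)(εθ)₀`.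
[cite: Enflo2023, v2 (2)–(5) p.2–3, (15)–(16) p.6, p.17 (window), p.19 l.661–677 (margin)] -/
theorem exists_far_start (hw₀ : 0 ≤ w₀) (hw₁ : w₀ < 1) (hα : 0 < α) {σ : ℝ} (hσ : 0 < σ) (hσ1 : σ ≤ 1)
    (hασ : α ^ 2 ≤ σ / 100) :
    ∃ (x₀ : C3) (s₀ : State (TF w₀ (α ^ 2)) x₀ S), ‖x₀‖ = 1 ∧ 0.7 < ‖x₀ 0‖ ∧ 0.7 < ‖x₀ 1‖ ∧
      0 < s₀.etheta ∧
      ((0.09 : ℝ) + (22 / σ + 1) * s₀.etheta ≤ s₀.ε ^ 2 ∧ s₀.ε ^ 2 + (22 / σ + 1) * s₀.etheta ≤ 0.49) ∧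
      s₀.V = WF w₀ α ∧ s₀.ε ^ 2 = 1 / (4 + 2 * α ^ 4) ∧ s₀.etheta = α ^ 2 / (4 + 2 * α ^ 4) := by
  obtain ⟨hα10, hK⟩ := start_arith hα hσ hσ1 hασ
  have hw : |w₀| < 1 := abs_lt.2 ⟨by linarith, hw₁⟩
  have hα0 : α ≠ 0 := hα.ne'
  have hα4 : α ^ 4 ≤ 1 / 10 ^ 4 := by
    have := pow_le_pow_left₀ hα.le hα10 4; simpa using this
  -- the intertwiner
  obtain ⟨W, hW⟩ : ∃ W : ℓ2 →L[ℂ] C3, WF w₀ α = W := ⟨_, rfl⟩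
  have hWS : ∀ b, W (S b) = TF w₀ (α ^ 2) (W b) := by rw [← hW]; exact WF_intertwine hw hα0
  -- the bracket and the scale `λ = 1/‖X̂‖`
  have hX : zh + W (adjoint W zh) = Xh α := by rw [← hW]; exact bracket_zh hw hα0
  have hN2 : ‖Xh α‖ ^ 2 = 8 + 4 * α ^ 4 := norm_Xh_sq
  have hN0 : 0 < ‖Xh α‖ :=
    lt_of_pow_lt_pow_left₀ 2 (norm_nonneg _) (by rw [hN2, zero_pow two_ne_zero]; positivity)
  obtain ⟨l, hl⟩ : ∃ l : ℝ, ‖Xh α‖⁻¹ = l := ⟨_, rfl⟩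
  have hl0 : 0 < l := by rw [← hl]; exact inv_pos.2 hN0
  have hlN : l * ‖Xh α‖ = 1 := by rw [← hl]; exact inv_mul_cancel₀ hN0.ne'
  have hl2 : l ^ 2 = (8 + 4 * α ^ 4)⁻¹ := by rw [← hl, inv_pow, hN2]
  have hl2lo : (1 / 8.0004 : ℝ) ≤ l ^ 2 := by
    rw [hl2, one_div, inv_le_inv₀ (by positivity) (by positivity)]; linarith
  have hl2hi : l ^ 2 ≤ 1 / 8 := by
    rw [hl2, one_div, inv_le_inv₀ (by positivity) (by positivity)]; linarith [pow_nonneg hα.le 4]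
  -- `x₀`, `z`, the bracket
  obtain ⟨x₀, hx₀⟩ : ∃ x₀ : C3, ((l : ℝ) : ℂ) • Xh α = x₀ := ⟨_, rfl⟩
  obtain ⟨z, hz⟩ : ∃ z : C3, ((l : ℝ) : ℂ) • zh = z := ⟨_, rfl⟩
  have hx₀n : ‖x₀‖ = 1 := by
    rw [← hx₀, norm_smul, Complex.norm_real, Real.norm_of_nonneg hl0.le, hlN]
  have hzn : ‖z‖ ^ 2 = 2 * l ^ 2 := by
    rw [← hz, norm_smul, Complex.norm_real, Real.norm_of_nonneg hl0.le, mul_pow, norm_zh_sq]; ring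
  have hz0 : 0 < ‖z‖ := lt_of_pow_lt_pow_left₀ 2 (norm_nonneg _) (by rw [hzn, zero_pow two_ne_zero]; positivity)
  have hbr : IsBracket W x₀ z := by
    show z + W (adjoint W z) = x₀
    rw [← hz, map_smul, map_smul, ← smul_add, hX, hx₀]
  have hwin : (0.3 : ℝ) ≤ ‖z‖ ∧ ‖z‖ ≤ 0.7 :=
    window_of_sq' hz0 (by rw [hzn]; linarith) (by rw [hzn]; linarith)
  have hadj : adjoint W z = ((l : ℝ) : ℂ) • (((α : ℝ) : ℂ) • e 0 + ((α : ℝ) : ℂ) • e 1) := by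
    rw [← hz, map_smul, ← hW, adjoint_WF_zh]
  have hE : ‖adjoint W z‖ ^ 2 = 2 * α ^ 2 * l ^ 2 := by
    rw [hadj, norm_smul, mul_pow, norm_ae_sq, Complex.norm_real, Real.norm_of_nonneg hl0.le]; ring
  -- coordinates of `x₀`
  have hx0 : ‖x₀ 0‖ = 2 * l := by
    rw [← hx₀, PiLp.smul_apply, Xh_apply_zero, smul_eq_mul, norm_mul, Complex.norm_real,
      Real.norm_of_nonneg hl0.le]; norm_num; ring
  have hx1 : ‖x₀ 1‖ = 2 * l := by
    rw [← hx₀, PiLp.smul_apply, Xh_apply_one, smul_eq_mul, norm_mul, Complex.norm_real,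
      Real.norm_of_nonneg hl0.le]; norm_num; ring
  have hfar : (0.7 : ℝ) < 2 * l := lt_of_pow_lt_pow_left₀ 2 (by positivity) (by nlinarith)
  -- the state
  let s₀ : State (TF w₀ (α ^ 2)) x₀ S := ⟨W, hWS, ‖z‖, hwin, _, hbr.isMinimal⟩
  have hv : s₀.v = z := hbr.sub_eq
  have he : s₀.etheta = 2 * α ^ 2 * l ^ 2 := by
    rw [etheta_eq_eth, hv, eth_eq_of_isBracket hbr, hE]
  have hε : s₀.ε ^ 2 = 2 * l ^ 2 := hzn
  have hKE : (22 / σ + 1) * (2 * α ^ 2 * l ^ 2) ≤ 0.0575 := by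
    have h22 : 0 ≤ 22 / σ + 1 := by positivity
    calc (22 / σ + 1) * (2 * α ^ 2 * l ^ 2) = ((22 / σ + 1) * α ^ 2) * (2 * l ^ 2) := by ring
      _ ≤ 0.23 * (2 * (1 / 8)) := mul_le_mul hK (by linarith) (by positivity) (by norm_num)
      _ = 0.0575 := by norm_num
  refine ⟨x₀, s₀, hx₀n, by rw [hx0]; exact hfar, by rw [hx1]; exact hfar, ?_, ⟨?_, ?_⟩, hW.symm, ?_, ?_⟩
  · rw [he]; positivity
  · rw [he, hε]; linarith
  · rw [he, hε]; linarith
  · rw [hε, hl2]; field_simp; ring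
  · rw [he, hl2]; field_simp; ring

/-! ### E. Headline: the orbit residual fails, non-vacuously, at every modulus — including the text's `δ₂` -/

/-- **THE ORBIT RESIDUAL FAILS AT EVERY MODULUS `0 < σ ≤ 1`, NON-VACUOUSLY, FROM A FAR START.**  For the type-1
operator `T_{w₀,α²}` on `ℂ³` (`0 < w₀ < 1`, `0 < α`, `α² ≤ σ/100`) there is an admissible start — a unit `x₀`, a
TRUE MC state with `(εθ)₀ > 0` and the run's start margin, no vanishing coordinate of `y₀ = Ve₀` — at which
`IndepRunD T x₀ S (ιS S) σ β s₀` is FALSE for every ratio `0 < β ≤ σ²/1000`.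
[cite: Enflo2023, v2 (34) p.16; p.19 l.655–677; (45) p.19; (11) p.4] -/
theorem fails (hw₀ : 0 < w₀) (hw₁ : w₀ < 1) (hα : 0 < α) {σ : ℝ} (hσ : 0 < σ) (hσ1 : σ ≤ 1)
    (hασ : α ^ 2 ≤ σ / 100) :
    ∃ (x₀ : C3) (s₀ : State (TF w₀ (α ^ 2)) x₀ S), ‖x₀‖ = 1 ∧ ¬ IsNonCyclic (TF w₀ (α ^ 2)) x₀ ∧
      0 < s₀.etheta ∧
      ((0.09 : ℝ) + (22 / σ + 1) * s₀.etheta ≤ s₀.ε ^ 2 ∧ s₀.ε ^ 2 + (22 / σ + 1) * s₀.etheta ≤ 0.49) ∧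
      (∀ i, s₀.V (e 0) i ≠ 0) ∧ ¬ IsNonCyclic (TF w₀ (α ^ 2)) (s₀.V (e 0)) ∧
      ∀ β : ℝ, 0 < β → β ≤ σ ^ 2 / 1000 → ¬ IndepRunD (TF w₀ (α ^ 2)) x₀ S (ιS S) σ β s₀ := by
  obtain ⟨x₀, s₀, hx₀, hp, hq, he, hm, hV, -, -⟩ := exists_far_start hw₀.le hw₁ hα hσ hσ1 hασ
  have hw : |w₀| < 1 := abs_lt.2 ⟨by linarith, hw₁⟩
  have hα1 : α < 1 := by obtain ⟨h, -⟩ := start_arith hα hσ hσ1 hασ; linarith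
  have hτ : α ^ 2 ≠ 0 := pow_ne_zero 2 hα.ne'
  have hy : ∀ i, s₀.V (e 0) i ≠ 0 := fun i => by rw [hV]; exact WF_e_zero_apply_ne_zero hw hα hα1 i
  have hn : ∀ {c : ℂ}, (0.7 : ℝ) < ‖c‖ → c ≠ 0 := fun h h0 => by rw [h0, norm_zero] at h; norm_num at h
  exact ⟨x₀, s₀, hx₀, cyclic_of_ne hw₀.ne' hτ (hn hp) (hn hq), he, hm, hy, cyclic_of_ne hw₀.ne' hτ (hy 0) (hy 1),
    fun β hβ0 hβ => not_indepRunD_of_far hw₀.ne' hτ hx₀ hp hq hσ hσ1 hβ0 hβ s₀ hm⟩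

/-- **… IN PARTICULAR AT THE TEXT'S OWN MODULUS.**  With the standing numbers `w₀ = 10⁻²⁰`, `α = 10⁻²⁵`
(`τ = 10⁻⁵⁰`): `T` is of type 1 with `u₀`, `‖T‖ = 10⁻²⁰`, its type-1 constants at levels `≥ 2` are
`≤ ‖T‖² = 10⁻⁴⁰` with `δ₂ = 10⁻⁴w₀² = 10⁻⁴⁴` valid at level `2` (`type1_const`), and for EVERY modulus
`10⁻⁴⁸ ≤ σ ≤ 1` — so for every admissible value `≥ 10⁻⁴⁸` of the text's `δ₂` for this operator — there is an
admissible start (cyclic `x₀`, cyclic `y₀`, `(εθ)₀ > 0`, start margin) at which `IndepRunD` fails with modulus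
`σ` and any ratio `0 < β ≤ σ²/1000`.  (Smaller `σ`: take `α² ≤ σ/100` in `fails`.)
[cite: Enflo2023, v2 p.1, p.6, (34) p.16, p.19 l.655–677] -/
theorem fails_at_text_modulus {σ : ℝ} (hσ : (1e-48 : ℝ) ≤ σ) (hσ1 : σ ≤ 1) :
    Referee.Type1 (TF 1e-20 ((1e-25 : ℝ) ^ 2)) ∧ ‖TF 1e-20 ((1e-25 : ℝ) ^ 2)‖ = 1e-20 ∧
    ∃ (x₀ : C3) (s₀ : State (TF 1e-20 ((1e-25 : ℝ) ^ 2)) x₀ S), ‖x₀‖ = 1 ∧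
      ¬ IsNonCyclic (TF 1e-20 ((1e-25 : ℝ) ^ 2)) x₀ ∧ 0 < s₀.etheta ∧
      ((0.09 : ℝ) + (22 / σ + 1) * s₀.etheta ≤ s₀.ε ^ 2 ∧ s₀.ε ^ 2 + (22 / σ + 1) * s₀.etheta ≤ 0.49) ∧
      (∀ i, s₀.V (e 0) i ≠ 0) ∧ ¬ IsNonCyclic (TF 1e-20 ((1e-25 : ℝ) ^ 2)) (s₀.V (e 0)) ∧
      ∀ β : ℝ, 0 < β → β ≤ σ ^ 2 / 1000 → ¬ IndepRunD (TF 1e-20 ((1e-25 : ℝ) ^ 2)) x₀ S (ιS S) σ β s₀ :=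
  ⟨type1 (by norm_num), opNorm_TF (by norm_num) (by positivity) (by norm_num),
    fails (by norm_num) (by norm_num) (by norm_num) (lt_of_lt_of_le (by norm_num) hσ) hσ1
      (by norm_num at hσ ⊢; linarith)⟩

end Far

/-! ### F. Reading for the located gap (GAP.md §"Formaliser 2 gen-18", G3/G4) -/

/-- **WHAT THE ENDGAME NEEDS IS AN INVARIANT SUBSPACE NEAR `x₀`.**  In any Hilbert space: if `IndepRunD` holds at an
admissible start over `x₀` (any modulus `0 < σ ≤ 1`, ratio `0 < β ≤ σ²/1000`), then some non-zero NON-CYCLIC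
vector `w` of `T` lies within `0.7` of `x₀` (`0.3 ≤ ‖x₀ − w‖ ≤ 0.7`, `x₀ − w ⊥ orbit(w)`).  Contrapositively, over
an `x₀` at distance `> 0.7` from every non-cyclic vector — under `¬NIS`, EVERY unit `x₀` — the residual (34) with
one modulus fails at every admissible start, whatever `σ`; `Far.fails` shows the hypotheses the text names (type 1,
`‖T‖ = 10⁻²⁰`, window, margin, `(εθ)₀ > 0`, `σ` in the `δ₂`-range) do not exclude such `x₀`.
[cite: Enflo2023, v2 (34) p.16, p.19 l.655–677, (11) p.4, p.20–22] -/
theorem exists_nonCyclic_near_of_indepRunD {E H : Type*} [NormedAddCommGroup E] [InnerProductSpace ℂ E]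
    [CompleteSpace E] [NormedAddCommGroup H] [InnerProductSpace ℂ H] [CompleteSpace H] {P : Type*}
    [NormedAddCommGroup P] [NormedSpace ℝ P] [CompleteSpace P] (T : H →L[ℂ] H) (x₀ : H) (hx₀ : ‖x₀‖ = 1)
    (S : E →L[ℂ] E) (hS : ‖S‖ ≤ 1) {ι : P →+ (E →L[ℂ] E)} (hιs : ∀ (t : ℝ) (p : P), ι (t • p) = (t : ℂ) • ι p)
    (hι1 : ∀ p, ‖ι p‖ ≤ ‖p‖) (hιS : ∀ p, ι p ∘L S = S ∘L ι p) {σ β : ℝ} (hσ : 0 < σ) (hσ1 : σ ≤ 1)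
    (hβ0 : 0 < β) (hβ : β ≤ σ ^ 2 / 1000) (s₀ : State T x₀ S)
    (hstart : (0.09 : ℝ) + (22 / σ + 1) * s₀.etheta ≤ s₀.ε ^ 2 ∧
      s₀.ε ^ 2 + (22 / σ + 1) * s₀.etheta ≤ 0.49)
    (h : IndepRunD T x₀ S ι σ β s₀) :
    ∃ w : H, w ≠ 0 ∧ ‖x₀ - w‖ ≤ 0.7 ∧ x₀ - w ≠ 0 ∧ ∀ j : ℕ, ⟪x₀ - w, (T ^ j) w⟫_ℂ = 0 := by
  obtain ⟨w, hw0, hlo, hhi, horth⟩ := hasMCLimit_of_indepRunD T x₀ hx₀ S hS hιs hι1 hιS hσ hσ1 hβ0 hβ s₀ hstart h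
  exact ⟨w, hw0, hhi, sub_ne_zero_of_window hlo, horth⟩

end StepRealisation

end Literature.Analysis.OperatorTheory.Enflo2023

end
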